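import Summits.Ventures.CertifiedQuantumChemistry.Barriers.DifferencePencilCeiling
import HarnessLib

/-!
# Barrier (structural, PROVED), part 2: the additivity floor of same-class difference pencils for the
# DQGT1T2′ sector programme (`pqgT1T2pSectorEnergy`)

Sibling of `Barriers/DifferencePencilCeiling.lean` (chem-type-10, X1 item (6); chem-solver-4
`HOME/solver/diff/DESIGN.md` §1 (F2), sha16 5262a768ac94f1c1: «L_R(K⁺_μ) + L_R(F_B) ≤ L_R((1+μ)F_A) =
(1+μ)L_R(F_A) (a min is superadditive, positively homogeneous) ⇒ the pencil lower bound ≤ [L_R(A) −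
L_R(B)] − μW_A and the upper ≥ [L_R(A) − L_R(B)] + νW_B ⇒ … the bracket always contains L_R(A) −
L_R(B)»), for the cell's tighter production class `R = DQGT1T2′`: `P′_F := pqgT1T2pSectorEnergy` of the
file's `ℂ`-cast tables (Literature `RelaxationEnergyHierarchy`); a lower certificate with condition string
DQGT1T2′ proves `ℓ ≤ Re E_F` on every `IsDQGT1T2PrimeFeasibleSector a b` pair (the binder of the cell's
`lowerRow_of_forall_isDQGT1T2PrimeFeasibleSector`). Same five-line argument as the DQG part; every other
fixed-feasible-set class is covered verbatim by the pointwise §2 of the main file.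

HONEST FRAMING of the venture (verbatim): certified bounds for a stated model Hamiltonian in a stated
basis; not a claim about the real molecule or material beyond that model. Nothing here is a number about
any file. Everything is PROVED (0 sorry, no def).
-/

noncomputable section

namespace Summit.Ventures.CertifiedQuantumChemistry

open Matrix Finset
open Literature.MathematicalPhysics.QuantumLattice Literature.MathematicalPhysics.QuantumChemistry
open scoped ComplexOrder

/-! ## Value form for the DQGT1T2′ sector programme

The same three statements for the cell's tighter production class (`P′_F := pqgT1T2pSectorEnergy` of the
file's cast tables; certificates with condition string DQGT1T2′ prove `ℓ ≤ Re E_F` on every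
`IsDQGT1T2PrimeFeasibleSector a b` pair). Every other fixed-feasible-set class (DQGT1, DQGT1T2, the
spin-flip quotients, …) is covered verbatim by §2 and by the same five-line argument. -/

section DQGT1T2p

variable {k : ℕ}

/-- A value certified by the DQGT1T2′ class is below the DQGT1T2′ value (`le_csInf` on the non-empty
feasible set of the physical range). -/
theorem Model.le_pqgT1T2pSectorEnergy_of_forall (F : Model k) {a b : ℕ} (ha : a ≤ k) (hb : b ≤ k)
    {x : ℝ}
    (hx : ∀ γ Γ, IsDQGT1T2PrimeFeasibleSector a b γ Γ → x ≤
      (rdmEnergy (fun p q => (F.h p q : ℂ)) (fun p q r s => (F.eri p q r s : ℂ)) (F.ecore : ℂ) γ Γ).re) :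
    x ≤ pqgT1T2pSectorEnergy (fun p q => (F.h p q : ℂ)) (fun p q r s => (F.eri p q r s : ℂ))
      (F.ecore : ℂ) a b := by
  refine le_csInf (pqgT1T2pSectorEnergySet_nonempty _ _ _ (by simpa using ha) (by simpa using hb)) ?_
  rintro E ⟨γ, Γ, hf, rfl⟩
  exact hx γ Γ hf

/-- **(F2) AS PRINTED, DQGT1T2′ class**: `P′(c·F_A − F_B) + P′(F_B) ≤ c·P′(F_A)` for `c > 0` on the
physical range — superadditivity + positive homogeneity of the DQGT1T2′ value on the pencil. -/
theorem Model.pqgT1T2pSectorEnergy_pencil_add_le (FA FB : Model k) {a b : ℕ} (ha : a ≤ k)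
    (hb : b ≤ k) {c : ℚ} (hc : 0 < c) :
    pqgT1T2pSectorEnergy (fun p q => ((Model.lincomb c (-1) FA FB).h p q : ℂ))
          (fun p q r s => ((Model.lincomb c (-1) FA FB).eri p q r s : ℂ))
          ((Model.lincomb c (-1) FA FB).ecore : ℂ) a b +
        pqgT1T2pSectorEnergy (fun p q => (FB.h p q : ℂ)) (fun p q r s => (FB.eri p q r s : ℂ))
          (FB.ecore : ℂ) a b ≤
      (c : ℝ) * pqgT1T2pSectorEnergy (fun p q => (FA.h p q : ℂ)) (fun p q r s => (FA.eri p q r s : ℂ))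
          (FA.ecore : ℂ) a b := by
  have hc0 : (0 : ℝ) < (c : ℝ) := by exact_mod_cast hc
  set PK := pqgT1T2pSectorEnergy (fun p q => ((Model.lincomb c (-1) FA FB).h p q : ℂ))
    (fun p q r s => ((Model.lincomb c (-1) FA FB).eri p q r s : ℂ))
    ((Model.lincomb c (-1) FA FB).ecore : ℂ) a b with hPK
  set PB := pqgT1T2pSectorEnergy (fun p q => (FB.h p q : ℂ)) (fun p q r s => (FB.eri p q r s : ℂ))
    (FB.ecore : ℂ) a b with hPB
  have hkey : (PK + PB) / (c : ℝ) ≤ pqgT1T2pSectorEnergy (fun p q => (FA.h p q : ℂ))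
      (fun p q r s => (FA.eri p q r s : ℂ)) (FA.ecore : ℂ) a b := by
    refine Model.le_pqgT1T2pSectorEnergy_of_forall FA ha hb fun γ Γ hf => ?_
    have hK : PK ≤ (rdmEnergy (fun p q => ((Model.lincomb c (-1) FA FB).h p q : ℂ))
          (fun p q r s => ((Model.lincomb c (-1) FA FB).eri p q r s : ℂ))
          ((Model.lincomb c (-1) FA FB).ecore : ℂ) γ Γ).re :=
      pqgT1T2pSectorEnergy_le_rdmEnergy _ _ _ hf
    rw [Model.re_rdmEnergy_pencil] at hK
    have hB : PB ≤ (rdmEnergy (fun p q => (FB.h p q : ℂ)) (fun p q r s => (FB.eri p q r s : ℂ))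
          (FB.ecore : ℂ) γ Γ).re :=
      pqgT1T2pSectorEnergy_le_rdmEnergy _ _ _ hf
    rw [div_le_iff₀ hc0]
    linarith
  have h := (div_le_iff₀ hc0).1 hkey
  linarith

/-- **THE ADDITIVITY FLOOR, VALUE FORM (DQGT1T2′), lower side**: for a symmetric `F_A` with an upper
row `u_A`, `c ≥ 1` and a pencil value `ℓ` certified by the DQGT1T2′ class for `K = c·F_A − F_B`
(the binder of the cell's `lowerRow_of_forall_isDQGT1T2PrimeFeasibleSector`), the lower leg obeys
`ℓ − (c−1)·u_A ≤ P′_A − P′_B`. -/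
theorem pencilLower_le_pqgT1T2p_sub {FA : Model k} (FB : Model k) (hA : FA.IsSymmetric) {a b : ℕ}
    {c : ℚ} (hc : 1 ≤ c) (ℓ : ℚ) {uA : ℚ}
    (hℓ : ∀ γ Γ, IsDQGT1T2PrimeFeasibleSector a b γ Γ → ((ℓ : ℚ) : ℝ) ≤
      (rdmEnergy (fun p q => ((Model.lincomb c (-1) FA FB).h p q : ℂ))
        (fun p q r s => ((Model.lincomb c (-1) FA FB).eri p q r s : ℂ))
        ((Model.lincomb c (-1) FA FB).ecore : ℂ) γ Γ).re)
    (hU : UpperRow FA a b uA) :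
    ((ℓ - (c - 1) * uA : ℚ) : ℝ) ≤
      pqgT1T2pSectorEnergy (fun p q => (FA.h p q : ℂ)) (fun p q r s => (FA.eri p q r s : ℂ))
          (FA.ecore : ℂ) a b -
        pqgT1T2pSectorEnergy (fun p q => (FB.h p q : ℂ)) (fun p q r s => (FB.eri p q r s : ℂ))
          (FB.ecore : ℂ) a b := by
  obtain ⟨ha, hb, hu⟩ := hU
  have hF2 := Model.pqgT1T2pSectorEnergy_pencil_add_le FA FB ha hb (lt_of_lt_of_le zero_lt_one hc)
  have hℓK := Model.le_pqgT1T2pSectorEnergy_of_forall _ ha hb hℓ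
  -- P′_A ≤ E₀(A) ≤ u_A
  have hPA : pqgT1T2pSectorEnergy (fun p q => (FA.h p q : ℂ)) (fun p q r s => (FA.eri p q r s : ℂ))
      (FA.ecore : ℂ) a b ≤ ((uA : ℚ) : ℝ) :=
    (pqgT1T2pSectorEnergy_le_sectorGroundEnergy (Model.hamiltonian_isHermitian hA)
      (by simpa using ha) (by simpa using hb)).trans hu
  have hc' : (0 : ℝ) ≤ (c : ℝ) - 1 := by exact_mod_cast sub_nonneg.2 hc
  have hprod := mul_nonneg hc' (sub_nonneg.2 hPA)
  push_cast
  linarith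

/-- **DQGT1T2′, upper side**: for a symmetric `F_B` with an upper row `u_B`, `c′ ≥ 1` and a
DQGT1T2′-certified value `ℓ′` for `K′ = c′·F_B − F_A`: `P′_A − P′_B ≤ (c′−1)·u_B − ℓ′`. -/
theorem pqgT1T2p_sub_le_pencilUpper (FA : Model k) {FB : Model k} (hB : FB.IsSymmetric) {a b : ℕ}
    {c' : ℚ} (hc : 1 ≤ c') (ℓ' : ℚ) {uB : ℚ}
    (hℓ' : ∀ γ Γ, IsDQGT1T2PrimeFeasibleSector a b γ Γ → ((ℓ' : ℚ) : ℝ) ≤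
      (rdmEnergy (fun p q => ((Model.lincomb c' (-1) FB FA).h p q : ℂ))
        (fun p q r s => ((Model.lincomb c' (-1) FB FA).eri p q r s : ℂ))
        ((Model.lincomb c' (-1) FB FA).ecore : ℂ) γ Γ).re)
    (hU : UpperRow FB a b uB) :
    pqgT1T2pSectorEnergy (fun p q => (FA.h p q : ℂ)) (fun p q r s => (FA.eri p q r s : ℂ))
          (FA.ecore : ℂ) a b -
        pqgT1T2pSectorEnergy (fun p q => (FB.h p q : ℂ)) (fun p q r s => (FB.eri p q r s : ℂ))
          (FB.ecore : ℂ) a b ≤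
      (((c' - 1) * uB - ℓ' : ℚ) : ℝ) := by
  have h := pencilLower_le_pqgT1T2p_sub FA hB hc ℓ' hℓ' hU
  push_cast at h ⊢
  linarith

/-- **«The bracket always contains `L_R(A) − L_R(B)`», DQGT1T2′ class**: both legs of a two-sided
pencil bracket certified by the DQGT1T2′ class straddle `P′_A − P′_B`. -/
theorem pencilBracket_straddles_pqgT1T2p {FA FB : Model k} (hA : FA.IsSymmetric)
    (hB : FB.IsSymmetric) {a b : ℕ} {c c' : ℚ} (hc : 1 ≤ c) (hc' : 1 ≤ c') (ℓ ℓ' : ℚ) {uA uB : ℚ}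
    (hℓ : ∀ γ Γ, IsDQGT1T2PrimeFeasibleSector a b γ Γ → ((ℓ : ℚ) : ℝ) ≤
      (rdmEnergy (fun p q => ((Model.lincomb c (-1) FA FB).h p q : ℂ))
        (fun p q r s => ((Model.lincomb c (-1) FA FB).eri p q r s : ℂ))
        ((Model.lincomb c (-1) FA FB).ecore : ℂ) γ Γ).re)
    (hUA : UpperRow FA a b uA)
    (hℓ' : ∀ γ Γ, IsDQGT1T2PrimeFeasibleSector a b γ Γ → ((ℓ' : ℚ) : ℝ) ≤
      (rdmEnergy (fun p q => ((Model.lincomb c' (-1) FB FA).h p q : ℂ))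
        (fun p q r s => ((Model.lincomb c' (-1) FB FA).eri p q r s : ℂ))
        ((Model.lincomb c' (-1) FB FA).ecore : ℂ) γ Γ).re)
    (hUB : UpperRow FB a b uB) :
    ((ℓ - (c - 1) * uA : ℚ) : ℝ) ≤
        pqgT1T2pSectorEnergy (fun p q => (FA.h p q : ℂ)) (fun p q r s => (FA.eri p q r s : ℂ))
            (FA.ecore : ℂ) a b -
          pqgT1T2pSectorEnergy (fun p q => (FB.h p q : ℂ)) (fun p q r s => (FB.eri p q r s : ℂ))
            (FB.ecore : ℂ) a b ∧
      pqgT1T2pSectorEnergy (fun p q => (FA.h p q : ℂ)) (fun p q r s => (FA.eri p q r s : ℂ))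
            (FA.ecore : ℂ) a b -
          pqgT1T2pSectorEnergy (fun p q => (FB.h p q : ℂ)) (fun p q r s => (FB.eri p q r s : ℂ))
            (FB.ecore : ℂ) a b ≤
        (((c' - 1) * uB - ℓ' : ℚ) : ℝ) :=
  ⟨pencilLower_le_pqgT1T2p_sub FB hA hc ℓ hℓ hUA, pqgT1T2p_sub_le_pencilUpper FA hB hc' ℓ' hℓ' hUB⟩

end DQGT1T2p
end Summit.Ventures.CertifiedQuantumChemistry

end
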